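/-
Copyright (c) 2026 the pub-hodgecm-mathlib formalisation cell (harness21).  Prover seat hodgecm-mathlib-K2E3-p05 (g0), Track B «K2-LIT», engine E3, unit U4 «Keys»,
2026-09-04.  KERNEL module: THEOREMS ONLY (no definition, no named fact, no `sorry`, no instance, no notation).
-/
import Summits.HodgeConjecture.HodgeConjecture.Theorems.K2E3NonUnitaryCharacterDichotomy   -- ★ (this seat) `exists_uniformizer_zpow_mul`; brings ★ TorusRay ∕ TorusCompactPart (`mem_unitsIntegers_iff`)
import Literature.NumberTheory.Automorphic.CMPrincipalSeriesSpherical                       -- ★ `halfModulusChar_eq_one_of_forall_v_eq_one`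
import Literature.NumberTheory.Automorphic.CMLocalRingModulusContinuous                     -- ★ `continuous_halfModulusChar_apply`
import HarnessLib

/-!
# K2 ∕ E3 «EllipticInputs», unit U4 «Keys» — Road II stub II-4, translation step: an UNRAMIFIED quasi-character of `E_vˣ` is pinned by its value at a
# uniformiser; `χ₁ = ‖·‖_E` iff `χ₁(ϖ) = ‖ϖ‖_E`; the `η` of case (2) is `χ₁‖·‖^{-1/2}` [WeilBNT1967 I §4; Rogawski1990 §12.2 (1)(2); Keys1984 §7 Thm (2) (a)(c)]

Cell hodgecm-mathlib (D-0151), FLOOR 0, Track B «K2-LIT», engine E3, crux item H413 = stmt-HodgeConjecture-24833 (route `HCCMUnconditional`, no route verbs); target BY NAME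
`…K2E3EllipticInputs.U4Keys.sig_K2E3KeysThmTwoContracting` (U4-f), unramified first rung (Road II of MEMO `hK-KeysThmTwo`, addendum v2): the assembly II-4 reads the four
equations of ★ `K2E3ParahoricReducibilityCriterion` as `z = χ₁(ϖ) ∈ {q_E^{±1}, −q_F^{±1}}` and must turn a value at `ϖ` into an identity of CHARACTERS in the organ's
disjuncts `χ₁ = ‖·‖^{±1}` ∕ `χ₁ = η‖·‖^{±1/2}`.  This file is that translation (no parahorics, no representation theory).  Author K2E3-p05 (g0).
`--supports stmt-HodgeConjecture-24833 --as helper`; THEOREMS ONLY.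

THE MATHEMATICS (`v` non-split, `E_vˣ = ϖ^ℤ·𝒪_vˣ` ★ `exists_uniformizer_zpow_mul`): two characters trivial on `𝒪_vˣ` that agree at a uniformiser unit `ϖ` agree
(§1 `eq_of_forall_unitsIntegers_of_apply_uniformizer_eq`); `‖·‖^{1/2}` is trivial on `𝒪_vˣ` (§2, ★ `halfModulusChar_eq_one_of_forall_v_eq_one`), hence so is `‖·‖`; so an
unramified `χ₁` with `χ₁(ϖ) = ‖ϖ‖` IS `‖·‖ = halfModulusChar²` (§3 `eq_halfModulusChar_sq_of_apply_uniformizer`), with `χ₁(ϖ) = ‖ϖ‖⁻¹` it is `‖·‖⁻¹`; and any `χ₁` is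
`η·‖·‖^{±1/2}` with `η := χ₁‖·‖^{∓1/2}` continuous when `χ₁` is (§4, ★ `continuous_halfModulusChar_apply`) — so that case (2) of the assembly only has to show
`IsQuadraticCharExtension σ η` for that explicit `η` (the unit-norm lemma of the addendum, NOT here).
HONEST LABEL: HC_CM is proved only modulo the 7 printed citations (2 remaining named inputs: hLiu418 = stmt-HodgeConjecture-24832, h413 = stmt-HodgeConjecture-24833)
until rung 0 closes; count-neutral (elementary; no printed citation is discharged).

## References
* [WeilBNT1967] A. Weil, *Basic Number Theory* (1967), Ch. I §4.  * [Rogawski1990] J. D. Rogawski, Ann. of Math. Stud. 123 (1990), §12.2 (1)(2) p. 173.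
* [Keys1984] D. Keys, Compositio Math. 51 (1984), §7 Thm (2) (a)(c) (the unramified reducibility points).
-/

set_option autoImplicit false
-- the mandated namespace has the single-problem summit's repeated segment (`HodgeConjecture.HodgeConjecture`)
set_option linter.dupNamespace false

noncomputable section

open NumberField IsDedekindDomain MeasureTheory
open Literature.NumberTheory.Automorphic Literature.NumberTheory.Automorphic.UnitaryGroup

namespace Summit.HodgeConjecture.HodgeConjecture.Cruxes.H413.K2E3UnramifiedCharacterValueAtUniformizer

variable (L : Type) [Field L] [NumberField L] [IsCMField L] (v : HeightOneSpectrum (𝓞 ↥(maximalRealSubfield L)))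

/-! ## §1 Two unramified characters that agree at a uniformiser agree -/

/-- **An unramified quasi-character is pinned by its value at `ϖ`** (`v` non-split): if `χ, χ′ : E_vˣ → ℂˣ` are trivial on `𝒪_vˣ` and `χ ϖ = χ′ ϖ` for a uniformiser unit
`ϖ`, then `χ = χ′` (`x = ϖⁿ u`, ★ `exists_uniformizer_zpow_mul`). [cite: WeilBNT1967, Ch. I §4] -/
theorem eq_of_forall_unitsIntegers_of_apply_uniformizer_eq (hns : ∀ w : PlacesOver L v, IsCMField.complexConj L • w.1 = w.1)
    (ϖ : (LocalRing L v)ˣ) (hϖ : ∀ w : PlacesOver L v, Valued.v ((ϖ : LocalRing L v) w) = WithZero.exp (-1 : ℤ))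
    (χ χ' : (LocalRing L v)ˣ →* ℂˣ)
    (hχ : ∀ u ∈ (Submonoid.pi Set.univ (fun w : PlacesOver L v => (w.1.adicCompletionIntegers L).toSubring.toSubmonoid)).units, χ u = 1)
    (hχ' : ∀ u ∈ (Submonoid.pi Set.univ (fun w : PlacesOver L v => (w.1.adicCompletionIntegers L).toSubring.toSubmonoid)).units, χ' u = 1)
    (hϖχ : χ ϖ = χ' ϖ) : χ = χ' := by
  refine MonoidHom.ext fun x => ?_
  obtain ⟨n, u, hu, hx, -⟩ := K2E3NonUnitaryCharacterDichotomy.exists_uniformizer_zpow_mul L v hns ϖ hϖ x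
  rw [hx, map_mul, map_mul, map_zpow, map_zpow, hχ u hu, hχ' u hu, hϖχ]

/-! ## §2 `‖·‖^{1/2}` (hence `‖·‖`) is trivial on `𝒪_vˣ` -/

omit [IsCMField L] in
/-- **`‖u‖^{1/2} = 1` for `u ∈ 𝒪_vˣ`** (★ `halfModulusChar_eq_one_of_forall_v_eq_one` + ★ `mem_unitsIntegers_iff`); any finite `v`. [cite: WeilBNT1967, Ch. I §4] -/
theorem halfModulusChar_eq_one_of_mem_unitsIntegers (u : (LocalRing L v)ˣ)
    (hu : u ∈ (Submonoid.pi Set.univ (fun w : PlacesOver L v => (w.1.adicCompletionIntegers L).toSubring.toSubmonoid)).units) :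
    halfModulusChar (LocalRing L v) u = 1 :=
  halfModulusChar_eq_one_of_forall_v_eq_one L v u ((F0P3cStCharTSTorusCompactPart.mem_unitsIntegers_iff L v u).1 hu)

/-! ## §3 `χ₁ = ‖·‖^{±1}` from the value at `ϖ` -/

/-- **An unramified `χ₁` with `χ₁(ϖ) = ‖ϖ‖` (i.e. `= ‖ϖ‖^{1/2}·‖ϖ‖^{1/2}`) IS `‖·‖ = halfModulusChar · halfModulusChar`** — the organ's spelling of Keys' point
`λ_s = |·|_E`, [Rogawski1990 §12.2 (1)] `χ₁ = ‖·‖`. [cite: Rogawski1990, §12.2 (1) p. 173] [cite: Keys1984, §7 Thm (2) (a)(c)] -/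
theorem eq_halfModulusChar_sq_of_apply_uniformizer (hns : ∀ w : PlacesOver L v, IsCMField.complexConj L • w.1 = w.1)
    (ϖ : (LocalRing L v)ˣ) (hϖ : ∀ w : PlacesOver L v, Valued.v ((ϖ : LocalRing L v) w) = WithZero.exp (-1 : ℤ))
    (χ₁ : (LocalRing L v)ˣ →* ℂˣ)
    (hχ : ∀ u ∈ (Submonoid.pi Set.univ (fun w : PlacesOver L v => (w.1.adicCompletionIntegers L).toSubring.toSubmonoid)).units, χ₁ u = 1)
    (hval : χ₁ ϖ = halfModulusChar (LocalRing L v) ϖ * halfModulusChar (LocalRing L v) ϖ) :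
    χ₁ = halfModulusChar (LocalRing L v) * halfModulusChar (LocalRing L v) :=
  eq_of_forall_unitsIntegers_of_apply_uniformizer_eq L v hns ϖ hϖ χ₁ _ hχ
    (fun u hu => by rw [MonoidHom.mul_apply, halfModulusChar_eq_one_of_mem_unitsIntegers L v u hu, one_mul]) hval

/-- **Dually: `χ₁(ϖ) = ‖ϖ‖⁻¹` gives `χ₁ = ‖·‖⁻¹ = (halfModulusChar · halfModulusChar)⁻¹`** ([Rogawski1990 §12.2 (1)] `χ₁ = ‖·‖⁻¹`). [cite: Rogawski1990, §12.2 (1) p. 173] -/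
theorem eq_halfModulusChar_sq_inv_of_apply_uniformizer (hns : ∀ w : PlacesOver L v, IsCMField.complexConj L • w.1 = w.1)
    (ϖ : (LocalRing L v)ˣ) (hϖ : ∀ w : PlacesOver L v, Valued.v ((ϖ : LocalRing L v) w) = WithZero.exp (-1 : ℤ))
    (χ₁ : (LocalRing L v)ˣ →* ℂˣ)
    (hχ : ∀ u ∈ (Submonoid.pi Set.univ (fun w : PlacesOver L v => (w.1.adicCompletionIntegers L).toSubring.toSubmonoid)).units, χ₁ u = 1)
    (hval : χ₁ ϖ = (halfModulusChar (LocalRing L v) ϖ * halfModulusChar (LocalRing L v) ϖ)⁻¹) :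
    χ₁ = (halfModulusChar (LocalRing L v) * halfModulusChar (LocalRing L v))⁻¹ :=
  eq_of_forall_unitsIntegers_of_apply_uniformizer_eq L v hns ϖ hϖ χ₁ _ hχ
    (fun u hu => by rw [MonoidHom.inv_apply, MonoidHom.mul_apply, halfModulusChar_eq_one_of_mem_unitsIntegers L v u hu, one_mul, inv_one]) hval

/-! ## §4 The `η` of case (2): `χ₁ = (χ₁‖·‖^{∓1/2})·‖·‖^{±1/2}`, continuous -/

omit [IsCMField L] in
/-- `χ₁ = (χ₁ · (‖·‖^{1/2})⁻¹) · ‖·‖^{1/2}` (group identity) — the `η` of [Rogawski1990 §12.2 (2)] `χ₁ = η‖·‖^{1/2}` is `χ₁‖·‖^{-1/2}`. [cite: Rogawski1990, §12.2 (2) p. 173] -/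
theorem eq_mul_halfModulusChar (χ₁ : (LocalRing L v)ˣ →* ℂˣ) :
    χ₁ = (χ₁ * (halfModulusChar (LocalRing L v))⁻¹) * halfModulusChar (LocalRing L v) :=
  MonoidHom.ext fun x => by rw [MonoidHom.mul_apply, MonoidHom.mul_apply, MonoidHom.inv_apply, inv_mul_cancel_right]

omit [IsCMField L] in
/-- `χ₁ = (χ₁ · ‖·‖^{1/2}) · (‖·‖^{1/2})⁻¹` — the `η` of `χ₁ = η‖·‖^{-1/2}` is `χ₁‖·‖^{1/2}`. [cite: Rogawski1990, §12.2 (2) p. 173] -/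
theorem eq_mul_halfModulusChar_inv (χ₁ : (LocalRing L v)ˣ →* ℂˣ) :
    χ₁ = (χ₁ * halfModulusChar (LocalRing L v)) * (halfModulusChar (LocalRing L v))⁻¹ :=
  MonoidHom.ext fun x => by rw [MonoidHom.mul_apply, MonoidHom.mul_apply, MonoidHom.inv_apply, mul_inv_cancel_right]

omit [IsCMField L] in
/-- **`η = χ₁‖·‖^{-1/2}` is continuous** when `χ₁` is (★ `continuous_halfModulusChar_apply`; the values of `‖·‖^{1/2}` are non-zero complex numbers).
[cite: Rogawski1990, §12.2 (2) p. 173] -/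
theorem continuous_coe_mul_halfModulusChar_inv (χ₁ : (LocalRing L v)ˣ →* ℂˣ) (h₁ : Continuous fun x => ((χ₁ x : ℂˣ) : ℂ)) :
    Continuous fun x => (((χ₁ * (halfModulusChar (LocalRing L v))⁻¹) x : ℂˣ) : ℂ) := by
  have h : (fun x => (((χ₁ * (halfModulusChar (LocalRing L v))⁻¹) x : ℂˣ) : ℂ)) =
      fun x => ((χ₁ x : ℂˣ) : ℂ) * (((halfModulusChar (LocalRing L v) x : ℂˣ) : ℂ))⁻¹ := by
    funext x
    rw [MonoidHom.mul_apply, MonoidHom.inv_apply, Units.val_mul, Units.val_inv_eq_inv_val]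
  rw [h]
  exact h₁.mul ((continuous_halfModulusChar_apply L v).inv₀ fun x => Units.ne_zero _)

omit [IsCMField L] in
/-- **`η = χ₁‖·‖^{1/2}` is continuous** when `χ₁` is. [cite: Rogawski1990, §12.2 (2) p. 173] -/
theorem continuous_coe_mul_halfModulusChar (χ₁ : (LocalRing L v)ˣ →* ℂˣ) (h₁ : Continuous fun x => ((χ₁ x : ℂˣ) : ℂ)) :
    Continuous fun x => (((χ₁ * halfModulusChar (LocalRing L v)) x : ℂˣ) : ℂ) := by
  have h : (fun x => (((χ₁ * halfModulusChar (LocalRing L v)) x : ℂˣ) : ℂ)) =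
      fun x => ((χ₁ x : ℂˣ) : ℂ) * ((halfModulusChar (LocalRing L v) x : ℂˣ) : ℂ) := by
    funext x
    rw [MonoidHom.mul_apply, Units.val_mul]
  rw [h]
  exact h₁.mul (continuous_halfModulusChar_apply L v)

end Summit.HodgeConjecture.HodgeConjecture.Cruxes.H413.K2E3UnramifiedCharacterValueAtUniformizer

end
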